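import Summits.Schanuel.Schanuel.Theorems.RootDecomp1KHeightGrading01

/-!
# RootDecomp1KHeightGrading — lens 1, generation 52, NODE 12 «THE HEIGHT GRADING: the thin-fibre clause graded by (deg_Y P, xdeg P) via the height transfer along the curve» (RULE K-R42 (P4)/(P2), K-R43) — continuation (RootDecomp1KHeightGrading02): §3 THEOREM A, §4 THEOREM B, §5 residual RE-GRADED, §6 the member H17P (geometric irreducibility, ThinFibreAt 2)

(lens-1 g52 NODE 12 HOME kernel K = HOME/decomp-schanuel-lens-1/g52/HeightGrading.lean d2c43eec…, 936 l, 89 thm + 14 def, imports tree …RootDecomp1KSubspaceBranch04 + Mathlib FieldTheory.IsAlgClosed.AlgebraicClosure, RingTheory.Polynomial.Eisenstein.Basic, NumberTheory.Height.NumberField ONLY; Probe HeightGradingProbe.lean rc 0 (116 axiom guards) / Ctrl0 rc 0 / Ctrl rc 1 = 22 planted; memo NODE-g52b.md with the DERIVATION MEMO (d1)–(d6); SHA256SUMS (25 entries); cite-kind ledger item wi-102467 (Lang 1983 Ch. 4 Cor. 3.5, curve case → consumption shape HeightComparison); CLAIM L2556, crit EX-ANTE PRICE L2560 (ONE THEOREM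 ×1 under RULE K-R42 (P4) iff CHECKLIST K-g52b; binder = the ε-form ONLY, label (β) paper corollary with derivation memo; RULES K-R43, K-R42 (vii′)), NODE L2563 / REQUEST L2564, census STAGING NOTE 2 L2565, critic VERDICT L2566: CLEARED — THEOREM ×1 under RULE K-R42 (P4), CHECKLIST K-g52b met, binder grade (β) under K-R43 with derivation memo (d1)–(d6); PORT GO (credit port, verbatim; MODs = docstrings + the one privatisation); lens-1 tally ×14 + THEOREM ×11. Port by census-1 gen 22 as `RootDecomp1KHeightGrading01–03` (`--supports stmt-Schanuel-33364`; no census credit): 01 = §0 `logHt` (= Mathlib's `Height.logHeight₁` on ℚ, `logHt_eq_logHeight₁`), `GeomIrreducible P` (irreducible over `AlgebraicClosure ℚ`), the ONE new input typed by name **`HeightComparison : Prop`** ([hypothesis] definition — the ε-form of the height comparison `|xdeg P · h(x) − deg_Y P · h(y)| ≤ ε·h(x) + c` on the rational points of a geometrically irreducible plane curve; sources in the docstring: Lang 1983 Ch. 4 Cor. 3.5, Bombieri–Gubler, Hindry–Silverman B.5.9, Serre; a THEOREM in print, NOT proved in the tree), `BddLevelEmpty` + §1 heights of rationals and of `x_N`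 + §2 the two asymptotic inequalities (real arithmetic); 02 = §3 THEOREM A **`thinFibreAt_of_heightComparison (hH) (hgi : GeomIrreducible P) (hk : 1 ≤ xdeg P) (hlt : P.natDegree < m₀ * xdeg P) : ThinFibreAt m₀ P`** + §4 THEOREM B **`thinFibreAt_iff_bddLevelEmpty_of_heightComparison`** (strict side `m₀ * xdeg P < P.natDegree`; `thinFibreAt_of_bddLevelEmpty` hyp-free) + §5 residual RE-GRADED (`HeightDecidedAt`, `HeightOffAt`, `HeightOnlyOffAt`, `thinFibre_of_padicSubspace_heightComparison`, `heightOffAt_of_offSbAt`; bookkeeping ×0) + §6 (first half) the member `H17P` = x³(Y²−17)² + x²Y + x(Y+1) + Y⁵ with `geomIrreducible_H17P` (Eisenstein at (x)) and `thinFibreAt_two_H17P`; 03 = §6 (second half) the COSTUME TEST BY NAME (`not_decidedAt_two_H17P`, `not_sepTopAt_H17P`, `thinThreshold_H17P`, …) + the boundary member `B17P` = Y² − 17x and the norm-form non-member `N2P` = Y² − 2x² (`not_geomIrreducible_N2P`). PORT EDITS: the generic one-liner `half_lt_log_two` PRIVATISED (dry-run dedup.foreign note: prints like `Summit.Parity.….log_two_gt_half`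 of another summit; used only inside §2); 27 one-line docstrings added on undocumented computation lemmas / member defs (statements quoted); `xdeg` is the TREE's `RootDecomp1KDegreeLadder.xdeg` (no re-declaration); K has no private decls, no set_option, no «[cite» token; the one `example` (xdeg of an x-linear presentation) kept; statements and proofs otherwise VERBATIM. Rung 0 — nothing here proves Schanuel, 33364, 33363, 31077 or ThinFibre 2; everything is CONDITIONAL on `HeightComparison` (and §5 also on `PadicSubspace`).)
-/

noncomputable section

namespace Summit.Schanuel.Schanuel.Theorems.RootDecomp1KHeightGrading

open Polynomial LiouvilleNumber
open scoped Nat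
open Summit.Schanuel.Schanuel.Theorems.RootDecomp1KSkelCell (SkelLiouvilleFix)
open Summit.Schanuel.Schanuel.Theorems.RootDecomp1KTwoBaseCell (psNumer partialSum_eq_psNumer_div coprime_psNumer
  partialSum_pos' partialSum_lt_two)
open Summit.Schanuel.Schanuel.Theorems.RootDecomp1KDegreeLadder
open Summit.Schanuel.Schanuel.Theorems.RootDecomp1KXLinearCore
open Summit.Schanuel.Schanuel.Theorems.RootDecomp1KXLinear
open Summit.Schanuel.Schanuel.Theorems.RootDecomp1KXLinearII
open Summit.Schanuel.Schanuel.Theorems.RootDecomp1KXTop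
open Summit.Schanuel.Schanuel.Theorems.RootDecomp1KXAll
open Summit.Schanuel.Schanuel.Theorems.RootDecomp1KLevelFinite
open Summit.Schanuel.Schanuel.Theorems.RootDecomp1KSubspaceBranch

/-! ### §3  THEOREM A: `deg_Y P < m₀ · xdeg P` is decided, modulo `HeightComparison` -/

/-- `0 < 1/(2m₀) ≤ 1` for `m₀ ≥ 1` (the `ε` at which the binder is used). -/
theorem eps_pos_le_one {m₀ : ℕ} (hm : 1 ≤ m₀) : 0 < 1 / (2 * (m₀ : ℝ)) ∧ 1 / (2 * (m₀ : ℝ)) ≤ 1 := by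
  have hm0 : (1 : ℝ) ≤ m₀ := by exact_mod_cast hm
  refine ⟨by positivity, ?_⟩
  rw [div_le_one (by positivity)]; linarith

/-- **THEOREM A** — the free regime UPGRADED from «`deg_Y P < m₀`» (tree `thinFibreAt_of_natDegree_lt`, Gauss, exponent
`1/n`) to «`deg_Y P < m₀ · xdeg P`» (height transfer, exponent `k/n`), modulo `HeightComparison`: for every geometrically
irreducible `P` with `xdeg P ≥ 1` and `P.natDegree < m₀ * xdeg P`, `ThinFibreAt m₀ P` — every `m₀`, every top
`x`-coefficient (separable or not, any `ℚ₂`-multiplicity), every order and branch at `(∞, ∞)`.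
HONESTY: at `xdeg P = 1` this is WEAKER than the tree's hypothesis-free `thinFibreAt_of_natDegree_lt` (same threshold,
no binder), and on lacunary / two-term presentations weaker than the hypothesis-free ladders of LevelFinite12–13 / XTop;
what the binder buys is the threshold `n < k·m₀` for EVERY geometrically irreducible `P`. -/
theorem thinFibreAt_of_heightComparison (hH : HeightComparison) {P : ℤ[X][X]} (hgi : GeomIrreducible P)
    (hk : 1 ≤ xdeg P) {m₀ : ℕ} (hlt : P.natDegree < m₀ * xdeg P) : ThinFibreAt m₀ P := by
  have hm : 1 ≤ m₀ := by
    rcases Nat.eq_zero_or_pos m₀ with h0 | h0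
    · subst h0; simp at hlt
    · exact h0
  by_cases hn : P.natDegree = 0
  · exact thinFibreAt_of_natDegree_lt (by rw [hn]; exact hm)
  have hn1 : 1 ≤ P.natDegree := Nat.one_le_iff_ne_zero.mpr hn
  obtain ⟨hε, hε1⟩ := eps_pos_le_one hm
  obtain ⟨c, hc⟩ := hH P hgi hk hn1 _ hε
  intro C
  obtain ⟨N₀, hN₀⟩ := clause_of_lower_height (n := P.natDegree) (k := xdeg P) (m₀ := m₀) hn1 hlt c C
  refine ⟨max N₀ 2, fun N hN r hrC hroot _ => ?_⟩
  have hNN₀ : N₀ ≤ N := le_trans (le_max_left _ _) hN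
  have hN2 : 2 ≤ N := le_trans (le_max_right _ _) hN
  have hx : bev P ((xQ N : ℚ) : ℝ) (r : ℝ) = 0 := by rw [xQ_cast]; exact hroot
  have hb := hc (xQ N) r hx
  have hlow := le_logHt_xQ hN2
  have hr := logHt_le_of_abs_le hrC
  refine hN₀ N hNN₀ r.den r.den_pos ?_
  have hk1 : (1 : ℝ) ≤ xdeg P := by exact_mod_cast hk
  have e1 : (xdeg P : ℝ) * logHt (xQ N) - (P.natDegree : ℝ) * logHt r ≤ 1 / (2 * (m₀ : ℝ)) * logHt (xQ N) + c :=
    (le_abs_self _).trans hb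
  have e4 : ((xdeg P : ℝ) - 1 / (2 * m₀)) * ((N ! : ℝ) * Real.log 2) ≤
      ((xdeg P : ℝ) - 1 / (2 * m₀)) * logHt (xQ N) := mul_le_mul_of_nonneg_left hlow (by linarith)
  have e5 : (P.natDegree : ℝ) * logHt r ≤ (P.natDegree : ℝ) * (Real.log (max C 1) + Real.log (r.den : ℝ)) :=
    mul_le_mul_of_nonneg_left hr (by positivity)
  have e6 : ((xdeg P : ℝ) - 1 / (2 * m₀)) * logHt (xQ N) =
      (xdeg P : ℝ) * logHt (xQ N) - 1 / (2 * (m₀ : ℝ)) * logHt (xQ N) := by ring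
  linarith

/-! ### §4  THEOREM B: for `deg_Y P > m₀ · xdeg P` the clause IS emptiness of the bounded fibres, modulo `HeightComparison` -/

/-- for `m₀ · xdeg P < deg_Y P` (`m₀ ≥ 1`) the clause `C·2^{(N+1)!} < den(r)^{m₀N}` FAILS at every rational point of
every large level (`C ≥ 1`), modulo `HeightComparison`. -/
theorem not_clause_eventually_of_heightComparison (hH : HeightComparison) {P : ℤ[X][X]} (hgi : GeomIrreducible P)
    (hk : 1 ≤ xdeg P) {m₀ : ℕ} (hm : 1 ≤ m₀) (hlt : m₀ * xdeg P < P.natDegree) {C : ℝ} (hC : 1 ≤ C) :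
    ∃ N₀ : ℕ, ∀ N : ℕ, N₀ ≤ N → ∀ r : ℚ, |(r : ℝ)| ≤ C → bev P (partialSum 2 N) r = 0 →
      ¬ (C * 2 ^ (N + 1)! < (r.den : ℝ) ^ (m₀ * N)) := by
  have hn1 : 1 ≤ P.natDegree := by omega
  obtain ⟨hε, hε1⟩ := eps_pos_le_one hm
  obtain ⟨c, hc⟩ := hH P hgi hk hn1 _ hε
  obtain ⟨N₀, hN₀⟩ := not_clause_of_upper_height (n := P.natDegree) (k := xdeg P) (m₀ := m₀) hm hlt c hC
  refine ⟨max N₀ 2, fun N hN r hrC hroot => ?_⟩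
  have hNN₀ : N₀ ≤ N := le_trans (le_max_left _ _) hN
  have hN2 : 2 ≤ N := le_trans (le_max_right _ _) hN
  have hx : bev P ((xQ N : ℚ) : ℝ) (r : ℝ) = 0 := by rw [xQ_cast]; exact hroot
  have hb := hc (xQ N) r hx
  have hupp := logHt_xQ_le hN2
  have hrlow := log_den_le_logHt r
  refine hN₀ N hNN₀ r.den r.den_pos ?_
  have e1 : (P.natDegree : ℝ) * logHt r - (xdeg P : ℝ) * logHt (xQ N) ≤ 1 / (2 * (m₀ : ℝ)) * logHt (xQ N) + c := by
    have := (neg_le_abs _).trans hb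
    linarith
  have e4 : ((xdeg P : ℝ) + 1 / (2 * m₀)) * logHt (xQ N) ≤
      ((xdeg P : ℝ) + 1 / (2 * m₀)) * ((N ! : ℝ) * Real.log 2 + Real.log 2) :=
    mul_le_mul_of_nonneg_left hupp (by positivity)
  have e5 : (P.natDegree : ℝ) * Real.log (r.den : ℝ) ≤ (P.natDegree : ℝ) * logHt r :=
    mul_le_mul_of_nonneg_left hrlow (by positivity)
  have e6 : ((xdeg P : ℝ) + 1 / (2 * m₀)) * logHt (xQ N) =
      (xdeg P : ℝ) * logHt (xQ N) + 1 / (2 * (m₀ : ℝ)) * logHt (xQ N) := by ring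
  linarith

/-- `ThinFibreAt m₀ P → BddLevelEmpty P` when `m₀ · xdeg P < deg_Y P` (`m₀ ≥ 1`; modulo `HeightComparison`): the
clause can only hold vacuously, so the bounded fibres are eventually EMPTY. -/
theorem bddLevelEmpty_of_thinFibreAt_of_heightComparison (hH : HeightComparison) {P : ℤ[X][X]}
    (hgi : GeomIrreducible P) (hk : 1 ≤ xdeg P) {m₀ : ℕ} (hm : 1 ≤ m₀) (hlt : m₀ * xdeg P < P.natDegree)
    (hT : ThinFibreAt m₀ P) : BddLevelEmpty P := by
  intro C
  obtain ⟨N₁, hN₁⟩ := hT (max C 1)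
  obtain ⟨N₂, hN₂⟩ := not_clause_eventually_of_heightComparison hH hgi hk hm hlt (le_max_right C 1)
  refine ⟨max N₁ N₂, fun N hN r hrC hroot hnd => ?_⟩
  have hrC' : |(r : ℝ)| ≤ max C 1 := hrC.trans (le_max_left _ _)
  exact hN₂ N (le_trans (le_max_right _ _) hN) r hrC' hroot
    (hN₁ N (le_trans (le_max_left _ _) hN) r hrC' hroot hnd)

/-- **THEOREM B** — for geometrically irreducible `P` with `xdeg P ≥ 1` and `m₀ · xdeg P < deg_Y P` (`m₀ ≥ 1`):
`ThinFibreAt m₀ P ↔ BddLevelEmpty P`, modulo `HeightComparison`.  (`←` is the hypothesis-free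
`thinFibreAt_of_bddLevelEmpty`; the boundary `deg_Y P = m₀ · xdeg P`, e.g. `Y² = 17x` at `m₀ = 2`, is NOT covered —
it would need the `O(√h)` form of the comparison (Néron), deliberately not a binder of this node.) -/
theorem thinFibreAt_iff_bddLevelEmpty_of_heightComparison (hH : HeightComparison) {P : ℤ[X][X]}
    (hgi : GeomIrreducible P) (hk : 1 ≤ xdeg P) {m₀ : ℕ} (hm : 1 ≤ m₀) (hlt : m₀ * xdeg P < P.natDegree) :
    ThinFibreAt m₀ P ↔ BddLevelEmpty P :=
  ⟨bddLevelEmpty_of_thinFibreAt_of_heightComparison hH hgi hk hm hlt, fun h => thinFibreAt_of_bddLevelEmpty h m₀⟩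

/-- THEOREM B in the tree's wording: `ThinFibreAt m₀ P ↔ LevelFinite P` (same hypotheses). -/
theorem thinFibreAt_iff_levelFinite_of_heightComparison (hH : HeightComparison) {P : ℤ[X][X]}
    (hgi : GeomIrreducible P) (hk : 1 ≤ xdeg P) {m₀ : ℕ} (hm : 1 ≤ m₀) (hlt : m₀ * xdeg P < P.natDegree) :
    ThinFibreAt m₀ P ↔ LevelFinite P :=
  (thinFibreAt_iff_bddLevelEmpty_of_heightComparison hH hgi hk hm hlt).trans (bddLevelEmpty_iff_levelFinite P)

/-- **THE GRADING IN ONE STATEMENT**: for geometrically irreducible `P` with `xdeg P ≥ 1` (`m₀ ≥ 1`), modulo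
`HeightComparison`: `ThinFibreAt m₀ P` holds outright if `deg_Y P < m₀ · xdeg P`, and is EQUIVALENT to the eventual
emptiness of the bounded fibres if `deg_Y P > m₀ · xdeg P`. -/
theorem thinFibreAt_grading (hH : HeightComparison) {P : ℤ[X][X]} (hgi : GeomIrreducible P) (hk : 1 ≤ xdeg P)
    {m₀ : ℕ} (hm : 1 ≤ m₀) :
    (P.natDegree < m₀ * xdeg P → ThinFibreAt m₀ P) ∧
      (m₀ * xdeg P < P.natDegree → (ThinFibreAt m₀ P ↔ BddLevelEmpty P)) :=
  ⟨fun hlt => thinFibreAt_of_heightComparison hH hgi hk hlt,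
    fun hlt => thinFibreAt_iff_bddLevelEmpty_of_heightComparison hH hgi hk hm hlt⟩

/-! ### §5  The residual of record RE-GRADED (bookkeeping, ×0 — said so) -/

/-- [class] definition (census convention): **decided by height at quality `m₀`** — geometrically irreducible with
`deg_Y P < m₀ · xdeg P` (THEOREM A; `xdeg P ≥ 1` is automatic). -/
def HeightDecidedAt (m₀ : ℕ) (P : ℤ[X][X]) : Prop :=
  GeomIrreducible P ∧ P.natDegree < m₀ * xdeg P

/-- the height class IS decided at `m₀`, modulo `HeightComparison`. -/
theorem thinFibreAt_of_heightDecidedAt (hH : HeightComparison) {m₀ : ℕ} {P : ℤ[X][X]} (h : HeightDecidedAt m₀ P) :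
    ThinFibreAt m₀ P := by
  have hk : 1 ≤ xdeg P := by
    rcases Nat.eq_zero_or_pos (xdeg P) with h0 | h0
    · have := h.2; rw [h0, mul_zero] at this; exact absurd this (Nat.not_lt_zero _)
    · exact h0
  exact thinFibreAt_of_heightComparison hH h.1 hk h.2

/-- [residual statement def — NOT proved; census convention] **Siegel's clause OFF everything decided at `m₀`, OFF the
subspace class AND OFF the height class** (`HeightOffAt` of CLAIM L2556): demanded only for primes outside
`DecidedAt m₀`, outside `SepTopAt m₀` and outside `HeightDecidedAt m₀` (not geometrically irreducible, or
`deg_Y P ≥ m₀ · xdeg P` — where, off the boundary, the clause IS emptiness of the bounded fibres, THEOREM B). -/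
def HeightOffAt (m₀ : ℕ) : Prop :=
  ∀ P : ℤ[X][X], Prime P → 2 ≤ P.natDegree → ¬ DecidedAt m₀ P → ¬ SepTopAt m₀ P → ¬ HeightDecidedAt m₀ P →
    SiegelClause P

/-- the weakening, PROVED: `SiegelShapesOffSbAt m₀ → HeightOffAt m₀`. -/
theorem heightOffAt_of_offSbAt {m₀ : ℕ} (h : SiegelShapesOffSbAt m₀) : HeightOffAt m₀ :=
  fun P hP hd hnd hns _ => h P hP hd hnd hns

/-- … hence from `SiegelShapesOff` (and so from `SiegelShapes` / the Literature fact via the tree's bridge, by name). -/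
theorem heightOffAt_of_off (h : SiegelShapesOff) {m₀ : ℕ} (hm : 2 ≤ m₀) : HeightOffAt m₀ :=
  heightOffAt_of_offSbAt (siegelShapesOffSbAt_of_off h hm)

/-- **THE RESIDUAL RE-GRADED**: `ThinFibre m₀ ⟸ PadicSubspace ∧ HeightComparison ∧ HeightOffAt m₀` (`m₀ ≥ 2`).
Bookkeeping ×0; no ∀-item moves; the Lang re-pointing of record (census bridge) untouched. -/
theorem thinFibre_of_padicSubspace_heightComparison {m₀ : ℕ} (hm : 2 ≤ m₀) (hS : PadicSubspace)
    (hH : HeightComparison) (hR : HeightOffAt m₀) : ThinFibre m₀ := by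
  refine thinFibre_of_prime hm fun P hP hd => ?_
  by_cases h : DecidedAt m₀ P
  · exact thinFibreAt_of_decidedAt hm hP.ne_zero h
  by_cases h' : SepTopAt m₀ P
  · exact thinFibreAt_of_sepTopAt hS hm h'
  by_cases h'' : HeightDecidedAt m₀ P
  · exact thinFibreAt_of_heightDecidedAt hH h''
  exact thinFibreAt_of_levelFinite (levelFinite_of_siegelClause (hR P hP hd h h' h'')) m₀

/-- … and the (b)-cell from it. -/
theorem b_of_padicSubspace_heightComparison {m₀ : ℕ} (hm : 2 ≤ m₀) (hS : PadicSubspace) (hH : HeightComparison)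
    (hR : HeightOffAt m₀) (ρ : ℝ) (hρ : SkelLiouvilleFix m₀ ρ) :
    AlgebraicIndependent ℚ ![((liouvilleNumber 2 : ℝ) : ℂ), (ρ : ℂ)] :=
  thinFibre_imp_b (by omega) (thinFibre_of_padicSubspace_heightComparison hm hS hH hR) ρ hρ

/-- [residual statement def — NOT proved; census convention] the SUBSPACE-FREE variant: Siegel's clause OFF
`DecidedAt m₀` and OFF the height class only. -/
def HeightOnlyOffAt (m₀ : ℕ) : Prop :=
  ∀ P : ℤ[X][X], Prime P → 2 ≤ P.natDegree → ¬ DecidedAt m₀ P → ¬ HeightDecidedAt m₀ P → SiegelClause P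

/-- the weakening, PROVED: `SiegelShapesOffAt m₀ → HeightOnlyOffAt m₀`. -/
theorem heightOnlyOffAt_of_offAt {m₀ : ℕ} (h : SiegelShapesOffAt m₀) : HeightOnlyOffAt m₀ :=
  fun P hP hd hnd _ => h P hP hd hnd

/-- `HeightOnlyOffAt m₀ → HeightOffAt m₀`. -/
theorem heightOffAt_of_onlyOffAt {m₀ : ℕ} (h : HeightOnlyOffAt m₀) : HeightOffAt m₀ :=
  fun P hP hd hnd _ hnh => h P hP hd hnd hnh

/-- `ThinFibre m₀ ⟸ HeightComparison ∧ HeightOnlyOffAt m₀` (`m₀ ≥ 2`; no `PadicSubspace`). -/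
theorem thinFibre_of_heightComparison_onlyOffAt {m₀ : ℕ} (hm : 2 ≤ m₀) (hH : HeightComparison)
    (hR : HeightOnlyOffAt m₀) : ThinFibre m₀ := by
  refine thinFibre_of_prime hm fun P hP hd => ?_
  by_cases h : DecidedAt m₀ P
  · exact thinFibreAt_of_decidedAt hm hP.ne_zero h
  by_cases h'' : HeightDecidedAt m₀ P
  · exact thinFibreAt_of_heightDecidedAt hH h''
  exact thinFibreAt_of_levelFinite (levelFinite_of_siegelClause (hR P hP hd h h'')) m₀

/-- … and the (b)-cell from it. -/
theorem b_of_heightComparison_onlyOffAt {m₀ : ℕ} (hm : 2 ≤ m₀) (hH : HeightComparison) (hR : HeightOnlyOffAt m₀)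
    (ρ : ℝ) (hρ : SkelLiouvilleFix m₀ ρ) : AlgebraicIndependent ℚ ![((liouvilleNumber 2 : ℝ) : ℂ), (ρ : ℂ)] :=
  thinFibre_imp_b (by omega) (thinFibre_of_heightComparison_onlyOffAt hm hH hR) ρ hρ

/-! ### §6  The member `H17P = x³·(Y² − 17)² + x²·Y + x·(Y + 1) + Y⁵` at `m₀ = 2` and its COSTUME TEST BY NAME -/

/-- the `x`-coefficients of `H17P`: `c₃ = (Y² − 17)²` (NOT separable; double roots `±√17 ∈ ℤ₂`, `μ_ℚ₂ = 2`),
`c₂ = Y`, `c₁ = Y + 1`, `c₀ = Y⁵`. -/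
def h17C : ℕ → ℤ[X] := fun j =>
  if j = 3 then (X ^ 2 - Polynomial.C 17) ^ 2 else if j = 2 then X else if j = 1 then X + Polynomial.C 1 else X ^ 5

/-- **THE MEMBER** `H17P = x³·(Y² − 17)² + x²·Y + x·(Y + 1) + Y⁵`: `xdeg = 3`, `deg_Y = 5 < 2·3`. -/
def H17P : ℤ[X][X] := xPolyP 3 h17C

/-- `h17C 3 = (X ^ 2 - Polynomial.C 17) ^ 2` (the non-separable top of `H17P`). -/
theorem h17C_three : h17C 3 = (X ^ 2 - Polynomial.C 17) ^ 2 := by simp [h17C]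
/-- `h17C 2 = X`. -/
theorem h17C_two : h17C 2 = X := by simp [h17C]
/-- `h17C 1 = X + Polynomial.C 1`. -/
theorem h17C_one : h17C 1 = X + Polynomial.C 1 := by simp [h17C]
/-- `h17C 0 = X ^ 5`. -/
theorem h17C_zero : h17C 0 = X ^ 5 := by simp [h17C]
/-- `c₃ = (m17C 2)²` — the square of node 11's separable top `Y² − 17`. -/
theorem h17C_three_eq_sq : h17C 3 = (m17C 2) ^ 2 := by rw [h17C_three, m17C_two]
/-- `{j : ℕ} (hj : 4 ≤ j) : h17C j = X ^ 5` (unused indices; only `j ≤ 3` enter `xPolyP 3 h17C`). -/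
theorem h17C_of_ge {j : ℕ} (hj : 4 ≤ j) : h17C j = X ^ 5 := by
  simp [h17C, show j ≠ 3 by omega, show j ≠ 2 by omega, show j ≠ 1 by omega]

/-- `(h17C 3).natDegree = 4`. -/
theorem natDegree_h17C_three : (h17C 3).natDegree = 4 := by
  rw [h17C_three, natDegree_pow, natDegree_X_pow_sub_C]

/-- `h17C 3 ≠ 0`. -/
theorem h17C_three_ne_zero : h17C 3 ≠ 0 := by
  rw [h17C_three]; exact pow_ne_zero _ (X_pow_sub_C_ne_zero (by norm_num) _)

/-- NO `x`-exponent is missing (`c_j ≠ 0` for all `j ≤ 3`): the x-lacunary ladder (`thinFibreAt_xPolyP_gap`) has gap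
`γ = 1` only and would need `deg_Y < 1·m₀`; `H17P` is not two-term. -/
theorem h17C_ne_zero {j : ℕ} (hj : j ≤ 3) : h17C j ≠ 0 := by
  intro h
  have h0 := congrArg (fun q : ℤ[X] => q.eval 1) h
  interval_cases j <;> simp [h17C_zero, h17C_one, h17C_two, h17C_three] at h0

/-- `(j : ℕ) : (h17C j).natDegree ≤ 5`. -/
theorem natDegree_h17C_le (j : ℕ) : (h17C j).natDegree ≤ 5 := by
  rcases Nat.lt_or_ge j 4 with hj | hj
  · interval_cases j
    · rw [h17C_zero, natDegree_X_pow]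
    · rw [h17C_one]; compute_degree!
    · rw [h17C_two, natDegree_X]; norm_num
    · rw [natDegree_h17C_three]; norm_num
  · rw [h17C_of_ge hj, natDegree_X_pow]

/-- `xdeg H17P = 3`. -/
theorem xdeg_H17P : xdeg H17P = 3 := xdeg_xPolyP 3 h17C h17C_three_ne_zero

/-- `topX H17P = (Y² − 17)²`. -/
theorem topX_H17P : topX H17P = h17C 3 := topX_xPolyP 3 h17C h17C_three_ne_zero

/-- the `Y⁵`-coefficient of `H17P` is `1`. -/
theorem coeff_H17P_five : H17P.coeff 5 = 1 := by
  ext i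
  rw [H17P, coeff_coeff_xPolyP, coeff_one]
  by_cases hi : i < 4
  · rw [if_pos (Finset.mem_range.mpr hi)]
    interval_cases i
    · rw [h17C_zero, coeff_X_pow]; simp
    · rw [h17C_one]; simp [coeff_X, coeff_one]
    · rw [h17C_two, coeff_X]; simp
    · rw [if_neg (by norm_num)]
      exact coeff_eq_zero_of_natDegree_lt (by rw [natDegree_h17C_three]; norm_num)
  · rw [if_neg (by rw [Finset.mem_range]; exact hi), if_neg (by omega)]

/-- `deg_Y H17P = 5`. -/
theorem natDegree_H17P : H17P.natDegree = 5 := by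
  refine le_antisymm (natDegree_xPolyP_le 3 h17C 5 fun j _ => natDegree_h17C_le j) ?_
  exact le_natDegree_of_ne_zero (by rw [coeff_H17P_five]; exact one_ne_zero)

/-- `H17P` is monic in `Y`. -/
theorem monic_H17P : H17P.Monic := by
  rw [Monic, leadingCoeff, natDegree_H17P, coeff_H17P_five]

/-- the evaluation `H17P(x, y) = y⁵ + x(y + 1) + x²y + x³(y² − 17)²`. -/
theorem bev_H17P (x y : ℝ) :
    bev H17P x y = y ^ 5 + x * (y + 1) + x ^ 2 * y + x ^ 3 * (y ^ 2 - 17) ^ 2 := by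
  rw [H17P, bev_xPolyP]
  simp [Finset.sum_range_succ, h17C_zero, h17C_one, h17C_two, h17C_three, map_ofNat]

/-- **`H17P` IS GEOMETRICALLY IRREDUCIBLE** — PROVED: Eisenstein at the prime `(x)` of `ℚ̄[x]` for `H17P` as a monic
polynomial in `Y` over `ℚ̄[x]` (`x ∣` every non-leading `Y`-coefficient since `c₀ = Y⁵` is the only `x`-free term,
and `x² ∤` the `Y⁰`-coefficient `x + 289x³`). -/
theorem geomIrreducible_H17P : GeomIrreducible H17P := by
  unfold GeomIrreducible
  set Q : Polynomial (Polynomial (AlgebraicClosure ℚ)) :=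
    H17P.map (mapRingHom (algebraMap ℤ (AlgebraicClosure ℚ))) with hQ
  have hmon : Q.Monic := monic_H17P.map _
  have hQdeg : Q.natDegree = 5 := by rw [hQ, monic_H17P.natDegree_map, natDegree_H17P]
  have hcoeff : ∀ i j : ℕ, (Q.coeff i).coeff j = algebraMap ℤ (AlgebraicClosure ℚ) ((H17P.coeff i).coeff j) := by
    intro i j; rw [hQ, coeff_map, coe_mapRingHom, coeff_map]
  have hE : Q.IsEisensteinAt (Ideal.span {X}) := by
    refine ⟨?_, fun {n} hn => ?_, ?_⟩
    · rw [hmon.leadingCoeff]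
      intro h1
      have htop : Ideal.span ({X} : Set (Polynomial (AlgebraicClosure ℚ))) = ⊤ := (Ideal.eq_top_iff_one _).mpr h1
      exact Polynomial.not_isUnit_X (Ideal.span_singleton_eq_top.mp htop)
    · rw [Ideal.mem_span_singleton, X_dvd_iff, hcoeff, H17P, coeff_coeff_xPolyP, if_pos (by simp), h17C_zero,
        coeff_X_pow]
      rw [hQdeg] at hn
      rw [if_neg (by omega), map_zero]
    · rw [Ideal.span_singleton_pow, Ideal.mem_span_singleton, X_pow_dvd_iff]
      intro h
      have h1 := h 1 (by norm_num)
      rw [hcoeff, H17P, coeff_coeff_xPolyP, if_pos (by simp), h17C_one] at h1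
      simp [coeff_X] at h1
  have hprime : (Ideal.span ({X} : Set (Polynomial (AlgebraicClosure ℚ)))).IsPrime :=
    (Ideal.span_singleton_prime X_ne_zero).mpr prime_X
  exact hE.irreducible hprime hmon.isPrimitive (by rw [hQdeg]; norm_num)

/-- `H17P` IS in the height class at every `m₀ ≥ 2` (`5 < 3·m₀`). -/
theorem heightDecidedAt_H17P {m₀ : ℕ} (hm : 2 ≤ m₀) : HeightDecidedAt m₀ H17P :=
  ⟨geomIrreducible_H17P, by rw [natDegree_H17P, xdeg_H17P]; omega⟩

/-- **THE MEMBER DECIDED**: `ThinFibreAt m₀ H17P` for EVERY `m₀ ≥ 2`, modulo `HeightComparison` — in particular AT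
`m₀ = 2`, where no tree theorem and no node-11 theorem reaches it (costume test below). -/
theorem thinFibreAt_H17P (hH : HeightComparison) {m₀ : ℕ} (hm : 2 ≤ m₀) : ThinFibreAt m₀ H17P :=
  thinFibreAt_of_heightDecidedAt hH (heightDecidedAt_H17P hm)

/-- `(hH : HeightComparison) : ThinFibreAt 2 H17P` — the member `H17P` decided at `m₀ = 2`, modulo `HeightComparison`. -/
theorem thinFibreAt_two_H17P (hH : HeightComparison) : ThinFibreAt 2 H17P := thinFibreAt_H17P hH le_rfl

end Summit.Schanuel.Schanuel.Theorems.RootDecomp1KHeightGrading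

end
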